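import Literature.Analysis.FluidPDE.CKNPressureLocalIntegrability
import Literature.Analysis.FluidPDE.CKNPressureLocalization
import Literature.Analysis.FluidPDE.HessianLaplacianLpProofs
import Literature.Analysis.FluidPDE.TruncatedNewtonHessian
import HarnessLib

/-!
# The splitting of the pressure under `(ℋ_CKN)` (Lemarié-Rieusset 2016, (13.20)): discharge

Analysis/FluidPDE proof file, sibling of `CKNPressureLocalization` (the named fact
`Literature.Analysis.FluidPDE.LemarieRieusset2016.pressure_splitting`: Lemarié-Rieusset 2016,
(13.20) p. 461 — under `(ℋ_CKN)` on a domain `Ω`, for `I × B(x_B, 2r_B) ⊆ Ω` the pressure splits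
on `I × B` as `p = ϖ_B + p_B + q_B` with `ϖ_B ∈ L^{5/3}_{t,x}`, `p_B ∈ L^{q₀}_t L^∞_x`,
`q_B ∈ L^∞_{t,x}`). This file PROVES it (`LemarieRieusset2016.pressure_splitting_holds`), now that
Stein's Proposition 3 is a theorem of the tree on `ℝ³`
(`stein1970_hessian_Lp_bound_holds_fin3`, `HessianLaplacianLpProofs`, from the Calderón–Zygmund
theory of `Literature/Analysis/SingularIntegrals/`).

## The splitting used

The printed splitting applies the Newtonian kernel `G` to the cut-off pressure `ζ_B p`; as in the
tree's proof of the local integrability of the pressure (`CKNPressureLocalIntegrability`) we use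
instead the **truncated** Newtonian kernel `Γ₀` at radii `(ρ/2, ρ)`, `ρ = r_B/2`, whose Laplacian
is `δ₀ - λ` with `λ = λ_{ρ/2,ρ}` smooth, radial, bounded (`|λ| ≤ L`) and supported in `|z| ≤ ρ`
(`NewtonKernel`, `NewtonLocalPotential`). With `p̃` a strongly measurable representative of
`𝟙_Ω p` we take

  `p_B(t, y) = Λ[p̃(t, ·)](y) = ∫ λ(z) p̃(t, y - z) dz`,  `ϖ_B = p - p_B`,  `q_B = 0`.

Then `|p_B(t, y)| ≤ L ∫ |p̃(t, x)| dx =: m(t)` everywhere, and `∫_I m^{q₀} < ∞` by hypothesis (3)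
of `(ℋ_CKN)` (`p ∈ L^{q₀}_t L¹_x(Ω)`) — this is the printed `p_B ∈ L^{q₀}_t L^∞_x(I × B)` with the
printed bound `|p_B(t,x)| ≤ C r_B⁻³ ∫ |p(t,y)| dy` — while `ϖ_B ∈ L^{5/3}_{t,x}(I × B)` is proved
**by duality**: for `θ ∈ C_c^∞(I × B)`, with `Θ = N_{ρ/2,ρ}[θ(t,·)]`, the pressure equation gives
`∫∫ p θ = ∫∫ p Λθ - ∫∫ D²Θ(u,u)` (`integral_pressure_mul_test_eq`), and `∫∫ p_B θ = ∫∫ p Λθ`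
(`λ` is even, Fubini slice-wise: `integral_mul_newtonFarSmoothing_comm`), so that
`∫∫ ϖ_B θ = -∫∫ D²Θ(u,u)`, which is bounded by `9 C ‖u‖²_{L^{10/3}(I × B(x_B, 3r_B/2))} ‖θ‖_{L^{5/2}}`
(`enorm_integral_hessian_newtonNearPotential_le`: Stein's bound at exponent `5/2` slice-wise and
`u ∈ L^{10/3}_{t,x}`, (13.18), `CKNVelocityIntegrability`); the converse of Hölder's inequality
(`Literature.Analysis.FunctionSpaces.lintegral_rpow_enorm_le_of_forall_test`) yields
`∫∫_{I×B} |ϖ_B|^{5/3} < ∞`. This `ϖ_B` differs from the printed `∑ ∂ⱼ∂ₗG * (ζ_B uⱼuₗ)` by bounded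
smooth terms only; the fact asserts the existence of a splitting with the three integrability
classes, which is what is proved.

## References

* P. G. Lemarié-Rieusset, *The Navier–Stokes Problem in the 21st Century*, CRC Press (2016),
  Def. 13.4 (p. 460), (13.17)–(13.21) (p. 461). [LemarieRieusset2016]
* E. M. Stein, *Singular integrals and differentiability properties of functions* (1970),
  Ch. III §1.3, Prop. 3. [Stein1971]
-/

noncomputable section

open MeasureTheory Set Function Filter Topology TopologicalSpace Metric InnerProductSpace
open scoped ENNReal NNReal RealInnerProductSpace

namespace Literature.Analysis.FluidPDE

/-! ### Pairing symmetry of `Λ` (the kernel `λ` is even, `newtonFarLaplacian_neg`) -/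

/-- **Pairing symmetry of the smoothing operator**: `∫ f Λ[g] = ∫ g Λ[f]` for `f ∈ L¹(ℝ³)` and
`g` continuous with compact support (`λ` even; Fubini for `(y, x) ↦ g(y) λ(y-x) f(x)`, which is
dominated by the product `|g(y)| · L|f(x)|`). [folklore] -/
theorem integral_mul_newtonFarSmoothing_comm {r₀ r₁ : ℝ} (h₀ : 0 < r₀) (h₁ : r₀ < r₁)
    {f g : EuclideanSpace ℝ (Fin 3) → ℝ} (hf : Integrable f) (hg : Continuous g)
    (hgc : HasCompactSupport g) :
    ∫ x, f x * newtonFarSmoothing r₀ r₁ g x = ∫ y, g y * newtonFarSmoothing r₀ r₁ f y := by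
  set lam : EuclideanSpace ℝ (Fin 3) → ℝ := newtonFarLaplacian r₀ r₁ with hlam
  have hlc : Continuous lam := continuous_newtonFarLaplacian h₀ h₁
  obtain ⟨L, hL⟩ := hlc.bounded_above_of_compact_support (hasCompactSupport_newtonFarLaplacian h₀.le h₁)
  have hL0 : 0 ≤ L := (norm_nonneg _).trans (hL 0)
  have hlam_even : ∀ z, lam (-z) = lam z := fun z => by
    rw [hlam]; exact newtonFarLaplacian_neg h₀ h₁ z
  have hgi : Integrable g := hg.integrable_of_hasCompactSupport hgc
  -- both smoothings as `∫ λ(· - y) (·)(y) dy`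
  have eΛg : ∀ x, newtonFarSmoothing r₀ r₁ g x = ∫ y, lam (x - y) * g y := fun x => by
    rw [newtonFarSmoothing_apply, ← integral_sub_left_eq_self (fun y => lam (x - y) * g y) volume x]
    refine integral_congr_ae (Eventually.of_forall fun z => ?_)
    simp only [sub_sub_cancel, hlam]
  have eΛf : ∀ y, newtonFarSmoothing r₀ r₁ f y = ∫ x, lam (y - x) * f x := fun y => by
    rw [newtonFarSmoothing_apply, ← integral_sub_left_eq_self (fun x => lam (y - x) * f x) volume y]
    refine integral_congr_ae (Eventually.of_forall fun z => ?_)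
    simp only [sub_sub_cancel, hlam]
  -- the jointly integrable function `H(y, x) = g(y) (λ(y - x) f(x))`
  set H : EuclideanSpace ℝ (Fin 3) × EuclideanSpace ℝ (Fin 3) → ℝ := fun q =>
    g q.1 * (lam (q.1 - q.2) * f q.2) with hH
  have hHm : AEStronglyMeasurable H ((volume : Measure (EuclideanSpace ℝ (Fin 3))).prod volume) := by
    refine ((hg.comp continuous_fst).aestronglyMeasurable).mul
      (((hlc.comp (continuous_fst.sub continuous_snd)).aestronglyMeasurable).mul ?_)
    exact hf.aestronglyMeasurable.comp_snd
  have hHi : Integrable H ((volume : Measure (EuclideanSpace ℝ (Fin 3))).prod volume) := by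
    refine Integrable.mono' (hgi.norm.mul_prod (hf.norm.const_mul L)) hHm
      (Eventually.of_forall fun q => ?_)
    rw [hH]; dsimp only
    rw [norm_mul, norm_mul]
    exact mul_le_mul_of_nonneg_left (mul_le_mul_of_nonneg_right (hL _) (norm_nonneg _))
      (norm_nonneg _)
  calc ∫ x, f x * newtonFarSmoothing r₀ r₁ g x
      = ∫ x, f x * ∫ y, lam (x - y) * g y := by simp_rw [eΛg]
    _ = ∫ x, ∫ y, H (y, x) := by
        refine integral_congr_ae (Eventually.of_forall fun x => ?_)
        rw [hH]; dsimp only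
        rw [← integral_const_mul]
        refine integral_congr_ae (Eventually.of_forall fun y => ?_)
        show f x * (lam (x - y) * g y) = g y * (lam (y - x) * f x)
        rw [← hlam_even (x - y), neg_sub]
        ring
    _ = ∫ y, ∫ x, H (y, x) := (integral_integral_swap hHi).symm
    _ = ∫ y, g y * ∫ x, lam (y - x) * f x := by
        refine integral_congr_ae (Eventually.of_forall fun y => ?_)
        rw [hH]; dsimp only
        rw [integral_const_mul]
    _ = ∫ y, g y * newtonFarSmoothing r₀ r₁ f y := by simp_rw [eΛf]

/-- The slicewise smoothing `(t, y) ↦ Λ[P(t, ·)](y)` of a strongly measurable `P` on `ℝ × ℝ³` is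
strongly measurable. [folklore] -/
theorem stronglyMeasurable_newtonFarSmoothing_slice {r₀ r₁ : ℝ} (h₀ : 0 < r₀) (h₁ : r₀ < r₁)
    {P : ℝ × EuclideanSpace ℝ (Fin 3) → ℝ} (hP : StronglyMeasurable P) :
    StronglyMeasurable fun w : ℝ × EuclideanSpace ℝ (Fin 3) =>
      newtonFarSmoothing r₀ r₁ (fun x => P (w.1, x)) w.2 := by
  have hF : StronglyMeasurable (uncurry fun (w : ℝ × EuclideanSpace ℝ (Fin 3))
      (z : EuclideanSpace ℝ (Fin 3)) => newtonFarLaplacian r₀ r₁ z * P (w.1, w.2 - z)) := by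
    refine (((continuous_newtonFarLaplacian h₀ h₁).comp continuous_snd).stronglyMeasurable).mul ?_
    exact hP.comp_measurable ((measurable_fst.comp measurable_fst).prodMk
      ((measurable_snd.comp measurable_fst).sub measurable_snd))
  exact hF.integral_prod_right

/-- **`∫∫ P Λθ = ∫∫ θ Λ[P(t,·)]`**: the pairing symmetry slice by slice in time, for `P` strongly
measurable with a.e. integrable slices and `θ` jointly continuous with compactly supported
slices, both space–time integrands being integrable. [folklore] -/
theorem integral_mul_newtonFarSmoothing_slice_comm {r₀ r₁ : ℝ} (h₀ : 0 < r₀) (h₁ : r₀ < r₁)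
    {P : ℝ × EuclideanSpace ℝ (Fin 3) → ℝ}
    (hPi : ∀ᵐ t ∂(volume : Measure ℝ), Integrable (fun x => P (t, x)))
    {θ : ℝ → EuclideanSpace ℝ (Fin 3) → ℝ} (hθc : Continuous (uncurry θ))
    (hθs : ∀ t, HasCompactSupport (θ t))
    (hI1 : Integrable (fun w : ℝ × EuclideanSpace ℝ (Fin 3) =>
      P w * newtonFarSmoothing r₀ r₁ (θ w.1) w.2))
    (hI2 : Integrable (fun w : ℝ × EuclideanSpace ℝ (Fin 3) =>
      θ w.1 w.2 * newtonFarSmoothing r₀ r₁ (fun x => P (w.1, x)) w.2)) :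
    ∫ w : ℝ × EuclideanSpace ℝ (Fin 3), P w * newtonFarSmoothing r₀ r₁ (θ w.1) w.2 =
      ∫ w : ℝ × EuclideanSpace ℝ (Fin 3),
        θ w.1 w.2 * newtonFarSmoothing r₀ r₁ (fun x => P (w.1, x)) w.2 := by
  rw [Measure.volume_eq_prod] at hI1 hI2 ⊢
  rw [integral_prod _ hI1, integral_prod _ hI2]
  refine integral_congr_ae ?_
  filter_upwards [hPi] with t ht
  exact integral_mul_newtonFarSmoothing_comm h₀ h₁ ht (hθc.comp (Continuous.prodMk_right t)) (hθs t)

/-! ### Tools -/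

/-- `L^r(Ω)` functions, `1 ≤ r`, are locally integrable on the open set `Ω ⊆ ℝ × ℝ³`. [folklore] -/
theorem locallyIntegrableOn_of_memLp_restrict' {F : Type*} [NormedAddCommGroup F]
    {g : ℝ × EuclideanSpace ℝ (Fin 3) → F} {Ω : Set (ℝ × EuclideanSpace ℝ (Fin 3))}
    (hΩ : IsOpen Ω) {r : ℝ≥0∞} (hr : 1 ≤ r) (hg : MemLp g r (volume.restrict Ω)) :
    LocallyIntegrableOn g Ω volume := by
  rw [locallyIntegrableOn_iff hΩ.isLocallyClosed]
  intro K hKΩ hK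
  have h1 : MemLp g r (volume.restrict K) := hg.mono_measure (Measure.restrict_mono hKΩ le_rfl)
  haveI : IsFiniteMeasure ((volume : Measure (ℝ × EuclideanSpace ℝ (Fin 3))).restrict K) :=
    ⟨by rw [Measure.restrict_apply_univ]; exact hK.measure_lt_top⟩
  exact memLp_one_iff_integrable.1 (h1.mono_exponent hr)

namespace LemarieRieusset2016

/-! ### The discharge -/

/-- **Discharge of the named fact `pressure_splitting`** (Lemarié-Rieusset 2016, (13.20) p. 461):
under `(ℋ_CKN)` with `ν > 0`, `q₀ > 1`, for `I × B(x_B, 2r_B) ⊆ Ω` the pressure splits on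
`I × B` as `p = ϖ_B + p_B + q_B` with `∫∫ |ϖ_B|^{5/3} < ∞`, `|p_B(t,·)| ≤ m(t)`, `∫_I m^{q₀} < ∞`,
`|q_B| ≤ K`. See the file docstring for the splitting used and the proof. [cite: LemarieRieusset2016, (13.20) p. 461] -/
theorem pressure_splitting_holds : pressure_splitting := by
  intro ν q₀ Ω f u p G hν hq₀ hH a b xB rB hab hrB hsub
  -- ### geometry
  set I : Set ℝ := Ioo a b with hI
  set B : Set (EuclideanSpace ℝ (Fin 3)) := ball xB rB with hB
  set S : Set (ℝ × EuclideanSpace ℝ (Fin 3)) := Ioo a b ×ˢ ball xB rB with hS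
  set ρ : ℝ := rB / 2 with hρ
  have hρ0 : 0 < ρ := by positivity
  have h₀ : 0 < ρ / 2 := by positivity
  have h₁ : ρ / 2 < ρ := by linarith
  set S' : Set (ℝ × EuclideanSpace ℝ (Fin 3)) := Ioo a b ×ˢ ball xB (rB + ρ) with hS'
  have hS'Ω : S' ⊆ (Ω : Set (ℝ × EuclideanSpace ℝ (Fin 3))) :=
    (Set.prod_mono Subset.rfl (ball_subset_ball (by rw [hρ]; linarith))).trans hsub
  have hSS' : S ⊆ S' := Set.prod_mono Subset.rfl (ball_subset_ball (by linarith))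
  have hSΩ : S ⊆ (Ω : Set (ℝ × EuclideanSpace ℝ (Fin 3))) := hSS'.trans hS'Ω
  have hSopen : IsOpen S := isOpen_Ioo.prod isOpen_ball
  have hq₀0 : 0 < q₀ := one_pos.trans hq₀
  -- ### the pressure: a strongly measurable representative `Pr` of `𝟙_Ω p`
  have hns := hH.solution
  have hu_loc := hns.1
  have hp_loc := hns.2.2.1
  have hpΩ : AEStronglyMeasurable (uncurry p)
      ((volume : Measure (ℝ × EuclideanSpace ℝ (Fin 3))).restrict Ω) :=
    hp_loc.aestronglyMeasurable
  have hind : AEStronglyMeasurable ((Ω : Set (ℝ × EuclideanSpace ℝ (Fin 3))).indicator (uncurry p))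
      (volume : Measure (ℝ × EuclideanSpace ℝ (Fin 3))) :=
    (aestronglyMeasurable_indicator_iff Ω.isOpen.measurableSet).2 hpΩ
  set Pr : ℝ × EuclideanSpace ℝ (Fin 3) → ℝ := hind.mk _ with hPrdef
  have hPrm : StronglyMeasurable Pr := hind.stronglyMeasurable_mk
  have hPrae : (Ω : Set (ℝ × EuclideanSpace ℝ (Fin 3))).indicator (uncurry p) =ᵐ[volume] Pr :=
    hind.ae_eq_mk
  -- the `L^{q₀}_t L¹_x` quantity, for `p` and for `Pr`
  set Pe : ℝ × EuclideanSpace ℝ (Fin 3) → ℝ≥0∞ :=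
    (Ω : Set (ℝ × EuclideanSpace ℝ (Fin 3))).indicator fun z => ‖p z.1 z.2‖ₑ with hPe
  have hPe' : Pe = fun z => ‖(Ω : Set (ℝ × EuclideanSpace ℝ (Fin 3))).indicator (uncurry p) z‖ₑ := by
    funext z; rw [hPe, enorm_indicator_eq_indicator_enorm]; rfl
  have hPePr : (fun z => ‖Pr z‖ₑ) =ᵐ[volume] Pe := by
    rw [hPe']
    filter_upwards [hPrae] with z hz
    rw [hz]
  set π : ℝ → ℝ≥0∞ := fun t => ∫⁻ x, Pe (t, x) with hπ
  set πr : ℝ → ℝ≥0∞ := fun t => ∫⁻ x, ‖Pr (t, x)‖ₑ with hπr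
  have hπrm : Measurable πr := hPrm.measurable.enorm.lintegral_prod_right'
  have hππr : πr =ᵐ[volume] π := by
    have h := hPePr
    rw [Measure.volume_eq_prod] at h
    filter_upwards [Measure.ae_ae_of_ae_prod h] with t ht
    exact lintegral_congr_ae ht
  have hpcl : ∫⁻ t, π t ^ q₀ < ∞ := hH.pressure_lt_top
  have hπrq : ∫⁻ t, πr t ^ q₀ < ∞ := by
    have H : (fun t => πr t ^ q₀) =ᵐ[volume] fun t => π t ^ q₀ :=
      hππr.mono fun t ht => by simp only [ht]
    rw [lintegral_congr_ae H]
    exact hpcl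
  have hπrfin : ∀ᵐ t ∂(volume : Measure ℝ), πr t < ∞ := by
    have h := ae_lt_top' (hπrm.pow_const q₀).aemeasurable hπrq.ne
    filter_upwards [h] with t ht
    by_contra hc
    rw [not_lt, top_le_iff] at hc
    rw [hc, ENNReal.top_rpow_of_pos hq₀0] at ht
    exact lt_irrefl _ ht
  have hPrint : ∀ᵐ t ∂(volume : Measure ℝ), Integrable (fun x => Pr (t, x)) := by
    filter_upwards [hπrfin] with t ht
    exact ⟨(hPrm.comp_measurable measurable_prodMk_left).aestronglyMeasurable, ht⟩
  -- `∫_I π < ∞`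
  have hπm : AEMeasurable π (volume : Measure ℝ) := by
    have h : AEMeasurable Pe (volume : Measure (ℝ × EuclideanSpace ℝ (Fin 3))) := by
      rw [hPe']; exact hind.enorm
    rw [Measure.volume_eq_prod] at h
    exact h.lintegral_prod_right'
  have hPi1 : ∫⁻ t in I, π t < ∞ := by
    have h := setLIntegral_rpow_lt_top_of_le volume (s := I) measure_Ioo_lt_top.ne hπm.restrict
      one_pos hq₀.le ((setLIntegral_le_lintegral I _).trans_lt hpcl)
    simpa only [ENNReal.rpow_one] using h
  -- `p ∈ L¹(S)`
  have hpS1 : ∫⁻ z in S, ‖p z.1 z.2‖ₑ ≤ ∫⁻ t in I, π t := by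
    calc ∫⁻ z in S, ‖p z.1 z.2‖ₑ = ∫⁻ z, S.indicator (fun z => ‖p z.1 z.2‖ₑ) z :=
          (lintegral_indicator hSopen.measurableSet _).symm
      _ ≤ ∫⁻ z, I.indicator (fun _ => (1 : ℝ≥0∞)) z.1 * Pe z := by
          refine lintegral_mono fun z => ?_
          by_cases hz : z ∈ S
          · rw [indicator_of_mem hz, indicator_of_mem hz.1, hPe, indicator_of_mem (hSΩ hz), one_mul]
          · rw [indicator_of_notMem hz]; exact zero_le
      _ ≤ ∫⁻ t, ∫⁻ x, I.indicator (fun _ => (1 : ℝ≥0∞)) t * Pe (t, x) := by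
          rw [Measure.volume_eq_prod]; exact lintegral_prod_le _
      _ = ∫⁻ t, I.indicator (fun _ => (1 : ℝ≥0∞)) t * π t := by
          refine lintegral_congr fun t => ?_
          rw [lintegral_const_mul' _ _ (by by_cases ht : t ∈ I <;> simp [ht])]
      _ = ∫⁻ t in I, π t := by
          rw [← lintegral_indicator measurableSet_Ioo]
          refine lintegral_congr fun t => ?_
          by_cases ht : t ∈ I
          · rw [indicator_of_mem ht, indicator_of_mem ht, one_mul]
          · rw [indicator_of_notMem ht, indicator_of_notMem ht, zero_mul]
  have hpS_meas : AEStronglyMeasurable (uncurry p)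
      ((volume : Measure (ℝ × EuclideanSpace ℝ (Fin 3))).restrict S) :=
    hpΩ.mono_measure (Measure.restrict_mono hSΩ le_rfl)
  have hpInt : IntegrableOn (uncurry p) S volume := ⟨hpS_meas, hpS1.trans_lt hPi1⟩
  -- ### the kernel bound `|λ| ≤ L`
  obtain ⟨L₀, hL₀⟩ := (continuous_newtonFarLaplacian h₀ h₁).bounded_above_of_compact_support
    (hasCompactSupport_newtonFarLaplacian h₀.le h₁)
  set L : ℝ≥0 := L₀.toNNReal with hLdef
  have hL : ∀ z, ‖newtonFarLaplacian (ρ / 2) ρ z‖ ≤ L := fun z =>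
    (hL₀ z).trans (Real.le_coe_toNNReal L₀)
  -- ### the three pieces
  set pB : ℝ → EuclideanSpace ℝ (Fin 3) → ℝ := fun t y =>
    newtonFarSmoothing (ρ / 2) ρ (fun x => Pr (t, x)) y with hpBdef
  set ϖ : ℝ → EuclideanSpace ℝ (Fin 3) → ℝ := fun t y => p t y - pB t y with hϖdef
  set m : ℝ → ℝ≥0∞ := fun t => (L : ℝ≥0∞) * πr t with hmdef
  have hpBm : StronglyMeasurable (uncurry pB) :=
    stronglyMeasurable_newtonFarSmoothing_slice h₀ h₁ hPrm
  have hpB_le : ∀ t y, ‖pB t y‖ₑ ≤ m t := fun t y =>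
    enorm_newtonFarSmoothing_half_le hL (fun x => Pr (t, x)) y
  have hpBS_meas : AEStronglyMeasurable (uncurry pB)
      ((volume : Measure (ℝ × EuclideanSpace ℝ (Fin 3))).restrict S) :=
    hpBm.aestronglyMeasurable
  -- `pB ∈ L¹(S)`: `∫_S |pB| ≤ |B| ∫_I m = |B| L ∫_I π < ∞`
  have hpBS1 : ∫⁻ z in S, ‖pB z.1 z.2‖ₑ < ∞ := by
    calc ∫⁻ z in S, ‖pB z.1 z.2‖ₑ ≤ ∫⁻ z in S, m z.1 := lintegral_mono fun z => hpB_le z.1 z.2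
      _ ≤ ∫⁻ t in I, ∫⁻ _x in B, m t := by
          rw [hS, Measure.volume_eq_prod, ← Measure.prod_restrict, ← hI, ← hB]
          exact lintegral_prod_le _
      _ = ∫⁻ t in I, m t * volume B := by
          simp only [lintegral_const, Measure.restrict_apply MeasurableSet.univ, univ_inter]
      _ = (∫⁻ t in I, m t) * volume B := lintegral_mul_const' _ _ measure_ball_lt_top.ne
      _ = (L : ℝ≥0∞) * (∫⁻ t in I, π t) * volume B := by
          rw [hmdef, lintegral_const_mul' _ _ ENNReal.coe_ne_top,
            setLIntegral_congr_fun_ae measurableSet_Ioo (hππr.mono fun t ht _ => ht)]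
      _ < ∞ := ENNReal.mul_lt_top (ENNReal.mul_lt_top ENNReal.coe_lt_top hPi1) measure_ball_lt_top
  have hpBInt : IntegrableOn (uncurry pB) S volume := ⟨hpBS_meas, hpBS1⟩
  have hϖInt : IntegrableOn (uncurry ϖ) S volume := by
    have e : uncurry ϖ = uncurry p - uncurry pB := by funext z; rfl
    rw [e]; exact hpInt.sub hpBInt
  -- ### the answer
  refine ⟨ϖ, pB, fun _ _ => 0, hϖInt.aestronglyMeasurable, hpBS_meas, aestronglyMeasurable_const,
    Eventually.of_forall fun z => ?_, ?_, ⟨m, measurable_const.mul hπrm,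
      Eventually.of_forall fun z => hpB_le z.1 z.2, ?_⟩, ⟨0, Eventually.of_forall fun z => by simp⟩⟩
  · -- `p = ϖ + pB + 0`
    simp only [hϖdef, sub_add_cancel, add_zero]
  · -- ### `∫∫_S |ϖ|^{5/3} < ∞` by duality
    -- constants: Stein at exponent `5/2`, the `L^{10/3}` norm of `u`
    obtain ⟨C, hC⟩ := stein1970_hessian_Lp_bound_holds_fin3.hessian_newtonNearPotential_half
      (p := ENNReal.ofReal (5 / 2)) (ENNReal.one_lt_ofReal.2 (by norm_num)) ENNReal.ofReal_lt_top
    have hum : AEStronglyMeasurable (uncurry u)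
        ((volume : Measure (ℝ × EuclideanSpace ℝ (Fin 3))).restrict S') :=
      (hu_loc.mono_set hS'Ω).aestronglyMeasurable
    set U : ℝ≥0∞ := ∫⁻ z in S', ‖u z.1 z.2‖ₑ ^ (10 / 3 : ℝ) with hU
    have hUfin : U < ∞ := hH.lintegral_rpow_ten_thirds_lt_top hS'Ω
    have hfi : LocallyIntegrableOn (uncurry f) (Ω : Set (ℝ × EuclideanSpace ℝ (Fin 3))) volume :=
      locallyIntegrableOn_of_memLp_restrict' Ω.isOpen (ENNReal.one_le_ofReal.2 (by norm_num))
        hH.force_memLp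
    set Kc : ℝ≥0∞ := 9 * C * U ^ (3 / 5 : ℝ) with hKc
    have hKcfin : Kc ≠ ∞ := ENNReal.mul_ne_top (ENNReal.mul_ne_top (by simp) ENNReal.coe_ne_top)
      (ENNReal.rpow_ne_top_of_nonneg (by norm_num) hUfin.ne)
    -- the dual bound for one test function
    have hdual : ∀ Ψ : ℝ × EuclideanSpace ℝ (Fin 3) → ℝ, ContDiff ℝ (⊤ : ℕ∞) Ψ →
        HasCompactSupport Ψ → tsupport Ψ ⊆ S →
        ‖∫ z in S, uncurry ϖ z * Ψ z‖ₑ ≤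
          Kc * (∫⁻ z in S, ‖Ψ z‖ₑ ^ (5 / 2 : ℝ)) ^ (2 / 5 : ℝ) := by
      intro Ψ hΨ1 hΨ2 hΨ3
      set θ : ℝ → EuclideanSpace ℝ (Fin 3) → ℝ := fun t x => Ψ (t, x) with hθdef
      have hθ : IsSpaceTimeTestOn (⟨Ioo a b ×ˢ ball xB rB, isOpen_Ioo.prod isOpen_ball⟩ :
          Opens (ℝ × EuclideanSpace ℝ (Fin 3))) θ := ⟨hΨ1, hΨ2, hΨ3⟩
      have hΨ0 : ∀ z, z ∉ S → Ψ z = 0 := fun z hz =>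
        image_eq_zero_of_notMem_tsupport fun h => hz (hΨ3 h)
      obtain ⟨CΨ, hCΨ⟩ := hΨ1.continuous.bounded_above_of_compact_support hΨ2
      have hΨm : AEStronglyMeasurable Ψ ((volume : Measure (ℝ × EuclideanSpace ℝ (Fin 3))).restrict S) :=
        hΨ1.continuous.aestronglyMeasurable
      -- the smoothing of `θ` and its support
      set Λθ : ℝ → EuclideanSpace ℝ (Fin 3) → ℝ := fun t => newtonFarSmoothing (ρ / 2) ρ (θ t)
        with hΛdef
      obtain ⟨hΛc, hΛsupp⟩ := tsupport_newtonFarSmoothing_slice_subset (ρ₀ := ρ / 2) hθ h₀.le h₁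
      have hΛcont : Continuous (uncurry Λθ) :=
        (contDiff_uncurry_newtonFarSmoothing_slice hθ h₀ h₁).continuous
      have hΛ0 : ∀ z, z ∉ (Ω : Set (ℝ × EuclideanSpace ℝ (Fin 3))) → uncurry Λθ z = 0 :=
        fun z hz => image_eq_zero_of_notMem_tsupport fun h => hz (hS'Ω (hΛsupp h))
      -- (a) `∫_S ϖ Ψ = ∫_S p Ψ - ∫_S pB Ψ`
      have ea : ∫ z in S, uncurry ϖ z * Ψ z =
          (∫ z in S, uncurry p z * Ψ z) - ∫ z in S, uncurry pB z * Ψ z := by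
        rw [← integral_sub (hpInt.mul_bdd hΨm (Eventually.of_forall fun z => hCΨ z))
          (hpBInt.mul_bdd hΨm (Eventually.of_forall fun z => hCΨ z))]
        refine integral_congr_ae (Eventually.of_forall fun z => ?_)
        change (p z.1 z.2 - pB z.1 z.2) * Ψ z = p z.1 z.2 * Ψ z - pB z.1 z.2 * Ψ z
        ring
      -- (b) `∫_S p Ψ = ∫_Ω p θ`
      have eb : ∫ z in S, uncurry p z * Ψ z =
          ∫ z in (Ω : Set (ℝ × EuclideanSpace ℝ (Fin 3))), p z.1 z.2 * θ z.1 z.2 := by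
        rw [setIntegral_eq_integral_of_forall_compl_eq_zero fun z hz => ?_,
          setIntegral_eq_integral_of_forall_compl_eq_zero fun z hz => ?_]
        · rfl
        · change p z.1 z.2 * Ψ (z.1, z.2) = 0
          rw [hΨ0 z fun h => hz (hSΩ h), mul_zero]
        · change p z.1 z.2 * Ψ z = 0
          rw [hΨ0 z hz, mul_zero]
      -- (c) `∫_S pB Ψ = ∫_Ω p Λθ`
      have I1 : Integrable (fun z : ℝ × EuclideanSpace ℝ (Fin 3) => Pr z * uncurry Λθ z) volume := by
        have h := integrable_mul_of_locallyIntegrableOn hp_loc hΛcont hΛc (hΛsupp.trans hS'Ω)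
          (fun z hz => image_eq_zero_of_notMem_tsupport hz)
        refine h.congr ?_
        filter_upwards [hPrae] with z hz
        rw [← hz]
        by_cases hzΩ : z ∈ (Ω : Set (ℝ × EuclideanSpace ℝ (Fin 3)))
        · rw [indicator_of_mem hzΩ]
        · rw [hΛ0 z hzΩ, indicator_of_notMem hzΩ, mul_zero, mul_zero]
      have I2 : Integrable (fun z : ℝ × EuclideanSpace ℝ (Fin 3) => θ z.1 z.2 * uncurry pB z) volume := by
        have h : IntegrableOn (fun z : ℝ × EuclideanSpace ℝ (Fin 3) => θ z.1 z.2 * uncurry pB z) S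
            volume := hpBInt.bdd_mul hΨm (Eventually.of_forall fun z => hCΨ z)
        refine (integrableOn_iff_integrable_of_support_subset fun z hz => ?_).1 h
        by_contra hzS
        exact hz (by change Ψ z * uncurry pB z = 0; rw [hΨ0 z hzS, zero_mul])
      have ec : ∫ z in S, uncurry pB z * Ψ z =
          ∫ z in (Ω : Set (ℝ × EuclideanSpace ℝ (Fin 3))), p z.1 z.2 * Λθ z.1 z.2 := by
        -- both sides as whole-space integrals
        have l1 : ∫ z in S, uncurry pB z * Ψ z = ∫ z, θ z.1 z.2 * uncurry pB z := by
          rw [setIntegral_eq_integral_of_forall_compl_eq_zero fun z hz => ?_]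
          · exact integral_congr_ae (Eventually.of_forall fun z => mul_comm _ _)
          · rw [hΨ0 z hz, mul_zero]
        have l2 : ∫ z in (Ω : Set (ℝ × EuclideanSpace ℝ (Fin 3))), p z.1 z.2 * Λθ z.1 z.2 =
            ∫ z, Pr z * uncurry Λθ z := by
          rw [setIntegral_eq_integral_of_forall_compl_eq_zero fun z hz => ?_]
          · refine integral_congr_ae ?_
            filter_upwards [hPrae] with z hz
            rw [← hz]
            by_cases hzΩ : z ∈ (Ω : Set (ℝ × EuclideanSpace ℝ (Fin 3)))
            · rw [indicator_of_mem hzΩ]; rfl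
            · change p z.1 z.2 * uncurry Λθ z = _
              rw [hΛ0 z hzΩ, indicator_of_notMem hzΩ, mul_zero, zero_mul]
          · change p z.1 z.2 * uncurry Λθ z = 0
            rw [hΛ0 z hz, mul_zero]
        rw [l1, l2]
        exact (integral_mul_newtonFarSmoothing_slice_comm h₀ h₁ hPrint
          (θ := θ) (show Continuous (uncurry θ) from hΨ1.continuous)
          (fun t => hθ.hasCompactSupport_slice t) I1 I2).symm
      -- the pressure equation and the Calderón–Zygmund bound
      have e2 := hns.integral_pressure_mul_test_eq hfi hH.divFree_force hρ0 hS'Ω hθ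
      have b2 := enorm_integral_hessian_newtonNearPotential_le (u := u) hC hρ0 hθ hum
        (Ω : Set (ℝ × EuclideanSpace ℝ (Fin 3)))
      have e : ∫ z in S, uncurry ϖ z * Ψ z =
          -∫ z in (Ω : Set (ℝ × EuclideanSpace ℝ (Fin 3))),
            fderiv ℝ (fderiv ℝ (newtonNearPotential (ρ / 2) ρ (θ z.1))) z.2 (u z.1 z.2)
              (u z.1 z.2) := by
        rw [ea, eb, ec, e2]; ring
      rw [e, enorm_neg]
      exact b2
    -- to the real-valued form
    have hT : ∀ Ψ : ℝ × EuclideanSpace ℝ (Fin 3) → ℝ, tsupport Ψ ⊆ S →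
        (∫⁻ z in S, ‖Ψ z‖ₑ ^ (5 / 2 : ℝ)) ^ (2 / 5 : ℝ) = eLpNorm Ψ (ENNReal.ofReal (5 / 2)) volume := by
      intro Ψ h3
      have hsupp : support (fun z : ℝ × EuclideanSpace ℝ (Fin 3) => ‖Ψ z‖ₑ ^ (5 / 2 : ℝ)) ⊆ S := by
        intro z hz
        by_contra hzS
        exact hz (by simp [image_eq_zero_of_notMem_tsupport (f := Ψ) (fun h' => hzS (h3 h')),
          ENNReal.zero_rpow_of_pos (by norm_num : (0 : ℝ) < 5 / 2)])
      rw [setLIntegral_eq_of_support_subset hsupp, lintegral_rpow_enorm_five_halves, ← ENNReal.rpow_mul,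
        show (5 / 2 : ℝ) * (2 / 5) = 1 by norm_num, ENNReal.rpow_one]
    have hbound : ∀ Ψ : ℝ × EuclideanSpace ℝ (Fin 3) → ℝ, ContDiff ℝ (⊤ : ℕ∞) Ψ →
        HasCompactSupport Ψ → tsupport Ψ ⊆ S →
        |∫ z in S, uncurry ϖ z * Ψ z| ≤
          Kc.toReal * (eLpNorm Ψ (ENNReal.ofReal (5 / 2)) volume).toReal := by
      intro Ψ h1 h2 h3
      have h := hdual Ψ h1 h2 h3
      rw [hT Ψ h3] at h
      have hEfin : eLpNorm Ψ (ENNReal.ofReal (5 / 2)) volume < ∞ :=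
        (h1.continuous.memLp_of_hasCompactSupport h2).eLpNorm_lt_top
      rw [← ENNReal.toReal_mul, ← ENNReal.ofReal_le_iff_le_toReal (ENNReal.mul_ne_top hKcfin
        hEfin.ne), ← Real.enorm_eq_ofReal_abs]
      exact h
    have hpq : Real.HolderConjugate (5 / 3) (5 / 2) :=
      Real.holderConjugate_iff.2 ⟨by norm_num, by norm_num⟩
    haveI : (volume : Measure (ℝ × EuclideanSpace ℝ (Fin 3))).IsAddHaarMeasure := by
      rw [Measure.volume_eq_prod]; infer_instance
    have hmain := FunctionSpaces.lintegral_rpow_enorm_le_of_forall_test hSopen hϖInt hpq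
      ENNReal.toReal_nonneg hbound
    exact hmain.trans_lt ENNReal.ofReal_lt_top
  · -- ### `∫_I m^{q₀} < ∞`
    calc ∫⁻ t in I, m t ^ q₀ = ∫⁻ t in I, (L : ℝ≥0∞) ^ q₀ * πr t ^ q₀ := by
          refine lintegral_congr fun t => ?_
          rw [hmdef, ENNReal.mul_rpow_of_nonneg _ _ hq₀0.le]
      _ = (L : ℝ≥0∞) ^ q₀ * ∫⁻ t in I, πr t ^ q₀ :=
          lintegral_const_mul' _ _ (ENNReal.rpow_ne_top_of_nonneg hq₀0.le ENNReal.coe_ne_top)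
      _ ≤ (L : ℝ≥0∞) ^ q₀ * ∫⁻ t, πr t ^ q₀ := mul_le_mul' le_rfl (setLIntegral_le_lintegral _ _)
      _ < ∞ := ENNReal.mul_lt_top (ENNReal.rpow_lt_top_of_nonneg hq₀0.le ENNReal.coe_ne_top) hπrq

end LemarieRieusset2016

end Literature.Analysis.FluidPDE
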